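/-
Copyright (c) 2026 the pub-hodgecm-mathlib formalisation cell (harness21).  Prover seat hodgecm-mathlib-LH7-p05 (g2) on the CHAIR K2-lead VALVE,
Track B «K2-LIT» ∕ hLiu418 #184♮ = `stmt-HodgeConjecture-24832`, Road I v3, FACE-G road (E), brick (E-g) «POLYNOMIAL PARTNER» — the SegalBargmann third (E-g-an),
FILE 1 (F4 lead K2Liu-p27 (g2) 23:21:29Z; LEAD F0P6-plan (g14) BATCH #131 (1); K2E5-r02 (g6) box (C)(F-i) 23:16:26Z (1)(2)).
THEOREMS ONLY (no `def`, no `instance`, no notation, no named-fact hypothesis, no `sorry`); lane `--supports stmt-HodgeConjecture-24832 --as helper`.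
-/
import Literature.Analysis.SegalBargmann.SchwartzHermiteDegreeComponents      -- ★ `degProjS`, `hasSum_degProjS`, `degProjS_eq_sum`, `degProjS_unitaryOpE_comm`
import Literature.NumberTheory.Weil1964.ArchMetaplecticSubgroup               -- ★ `MpS`, `MpS.unitary`, `MpS.exists_unitSmul_of_proj_eq`, `realifySp`
import Literature.NumberTheory.Weil1964.AdelicMetaplecticArchSection          -- ★ `carrierConjEquiv` (`e^* ∘ S ∘ e_*`)
import Literature.NumberTheory.Weil1964.ArchFollandTorusKType                 -- ★ `follandHermite e β = (e^*)⁻¹ h_β`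
import HarnessLib

/-!
# Crux `HLiu418`, FACE-G road (E), brick (E-g) «polynomial partner», SegalBargmann third — FILE 1: DEGREE TRUNCATION ALONG A FOLLAND FRAME CONVERGES IN `𝓢`,
# IS FOCK-FINITE, AND INTERTWINES EVERY FRAMED-COMPACT ARCHIMEDEAN OPERATOR

Cell `hodgecm-mathlib`, crux item hLiu418 = `stmt-HodgeConjecture-24832` (helper lane, count-neutral; closes no socket).  Namespace
`Summit.HodgeConjecture.HodgeConjecture.Cruxes.HLiu418.K2LiuArchSWDegreeTruncation`.  Generic over a Folland frame `e : D ≃L[ℝ] ℝ^σ` of a real normed space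
`D` (consumer: `D = (Fin (n′+n′)) → L⁺ ⊗ ℝ`, `σ = Fin (n′+n′) × {real places}`, `e = frameD` of the BIG doubled datum, ★ `GRConstruction.frameD` ∕ ★ p862796).

WHY (K2E5-r02 (g6) (F-i), RULING BATCH #131 (1)).  FACE-G's `∀ V` ranges over finite-dimensional `K̃_∞`-stable `V ⊂ 𝓢_∞` whose members need NOT be Fock-finite
(`v = Σ_d c_d v_d`, `(c_d)` rapidly decreasing), so (E-f) (which reaches `binvPi F` data) needs a POLYNOMIAL PARTNER: `∃ w` Fock-finite with `SW_∞(w) = SW_∞(a)`.  The partner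
is `lim` of the DEGREE TRUNCATIONS `Tr_N a` through ★ p863009 `K2LiuFockFinitePartnerOfClosedRange.exists_partner_of_tendsto_seq (T) (P) (SF) (hfin) (hv) (hvP) (hvS)`.
This file supplies `hv` and `hvP` (r02's (1)) and the type-free operational form of r02's (2):
* §1 (the model `𝓢(ℝ^σ)`): with `P := schwartzTransport (euclE σ)` (★, `𝓢(EuclideanSpace ℝ σ) ≃L 𝓢(ℝ^σ)`), the truncation `P (Σ_{d<N} Π_d (P⁻¹ g))` converges to `g`
  (`tendsto_truncPi`, ★ `hasSum_degProjS`), lies in `span {h_β : |β| < N}` (`truncPi_mem_span`, ★ `degProjS_eq_sum`), and COMMUTES WITH EVERY `x ∈ Mp^𝓢` OVER A UNITARY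
  `proj x = realify u` (`truncPi_apply_of_proj_eq_realifySp`: ★ `MpS.exists_unitSmul_of_proj_eq` ⇒ `x = c • μ₀(u)`, ★ `degProjS_unitaryOpE_comm`).
* §2 (any frame `e`): the truncation `Tr_N a := (e^*)⁻¹ P (Σ_{d<N} Π_d (P⁻¹ e^* a))` — `tendsto_degTrunc` (`Tr_N a → a` in `𝓢(D, ℂ)`), `degTrunc_mem_span` (`Tr_N a ∈ span
  {follandHermite e β : |β| < N}` — FOCK-FINITE of degree `< N`), `degTrunc_mem_span_range`, and **`degTrunc_carrierConjEquiv_of_proj_eq_realifySp`**: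
  `Tr_N (e^* x e_* a) = (e^* x e_*) (Tr_N a)` — truncation INTERTWINES every framed-compact archimedean operator `carrierConjEquiv e x.1.2` (the operators through which
  `K̃_∞` acts on the archimedean Schwartz factor: ★ `GRConstruction.omega_sD_archToAdelic_tmul`, scalar `η_t` aside), which is the operational content of «truncation keeps the
  `K̃_∞`-types of `V`» without a theory of types; §3 packages the three as ONE `∃ Tr : ℕ → (𝓢(D, ℂ) →L[ℂ] 𝓢(D, ℂ))` (`exists_degTrunc`).
NOT HERE: the CONTINUITY of `v ↦ (h ↦ swSectionTensor sB (E(v ⊗ f)) h)` (r02 (3), FILE 2 `K2LiuArchSWSectionContinuity`), the finiteness `hfin` of `SF.map T` ((E-g-fin), S2 hand),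
and the `tensorEmb ∘ archToAdelic` plumbing that reads `IsArchStable`'s operators as `c • carrierConjEquiv frameD x.1.2` on pure tensors (BY VALUE at the head).
References: [Folland1989, §1.7 (1.81), Ch. 4 §5 p. 182, §4.2 Prop. (4.39)]; [Howe1989, §3]; [MoeglinVignerasWaldspurger1987, Chap. 2 II.1 (A)]; [Rudin1991, Thm. 1.21].
HONEST LABEL: HC_CM is proved only modulo the 7 printed citations (2 remaining named inputs: hLiu418 = stmt-HodgeConjecture-24832, h413 = stmt-HodgeConjecture-24833) until
rung 0 closes; count-neutral helper (`--supports stmt-HodgeConjecture-24832 --as helper`), closes no socket, moves no counter.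
-/

set_option autoImplicit false
set_option linter.dupNamespace false -- the mandated namespace repeats `HodgeConjecture.HodgeConjecture`

noncomputable section

open Filter Topology SchwartzMap
open scoped BigOperators
open Literature.Analysis.SegalBargmann Literature.RepresentationTheory.HeisenbergGroup Literature.NumberTheory.Weil1964

namespace Summit.HodgeConjecture.HodgeConjecture.Cruxes.HLiu418.K2LiuArchSWDegreeTruncation

variable {σ : Type*} [Fintype σ] [DecidableEq σ]

/-! ## §1 The model `𝓢(ℝ^σ)`: truncation converges, is Hermite-finite, commutes with `Mp^𝓢` over `U(σ)` -/

section Model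

/-- **`P (Σ_{d<N} Π_d (P⁻¹ g)) → g` in `𝓢(ℝ^σ)`** (`P = schwartzTransport (euclE σ)`; ★ `hasSum_degProjS` pushed through the topological isomorphism `P`).
[cite: Folland1989, §1.7 (1.81)] -/
theorem tendsto_truncPi (g : SchwartzMap (σ → ℝ) ℂ) :
    Tendsto (fun N : ℕ => schwartzTransport (euclE σ)
      (∑ d ∈ Finset.range N, degProjS d ((schwartzTransport (euclE σ)).symm g))) atTop (𝓝 g) := by
  have h := ((schwartzTransport (euclE σ)).continuous.tendsto _).comp
    (hasSum_degProjS ((schwartzTransport (euclE σ)).symm g)).tendsto_sum_nat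
  rwa [ContinuousLinearEquiv.apply_symm_apply] at h

/-- the truncation lies in the span of the Hermite functions of degree `< N`. [cite: Folland1989, Ch. 4 §5 p. 182] -/
theorem truncPi_mem_span (g : SchwartzMap (σ → ℝ) ℂ) (N : ℕ) :
    schwartzTransport (euclE σ) (∑ d ∈ Finset.range N, degProjS d ((schwartzTransport (euclE σ)).symm g)) ∈
      Submodule.span ℂ {x : SchwartzMap (σ → ℝ) ℂ | ∃ β : σ →₀ ℕ, β.degree < N ∧ hermitePi β = x} := by
  rw [map_sum]
  refine Submodule.sum_mem _ fun d hd => ?_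
  rw [degProjS_eq_sum, map_sum]
  refine Submodule.sum_mem _ fun β hβ => ?_
  rw [map_smul]
  exact Submodule.smul_mem _ _ (Submodule.subset_span ⟨β, (mem_degEq.1 hβ).symm ▸ Finset.mem_range.1 hd, rfl⟩)

/-- **TRUNCATION COMMUTES WITH `Mp^𝓢` OVER `U(σ)`**: for `x ∈ Mp^𝓢(W)` over a unitary `proj x = realify u` (so `x = c • μ₀(u)`, ★ `MpS.exists_unitSmul_of_proj_eq`) and every `N`,
`P (Σ_{d<N} Π_d (P⁻¹ (x g))) = x (P (Σ_{d<N} Π_d (P⁻¹ g)))` (★ `degProjS_unitaryOpE_comm`: `μ₀(u)` preserves every degree block). [cite: Folland1989, §4.2 Prop. (4.39), Ch. 4 §5 p. 182]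
[cite: MoeglinVignerasWaldspurger1987, Chap. 2 II.1 (A)] -/
theorem truncPi_apply_of_proj_eq_realifySp {x : MpS σ} {u : Matrix.unitaryGroup σ ℂ} (hx : MpS.proj x = realifySp σ u)
    (g : SchwartzMap (σ → ℝ) ℂ) (N : ℕ) :
    schwartzTransport (euclE σ) (∑ d ∈ Finset.range N, degProjS d ((schwartzTransport (euclE σ)).symm (x.1.2 g))) =
      x.1.2 (schwartzTransport (euclE σ) (∑ d ∈ Finset.range N, degProjS d ((schwartzTransport (euclE σ)).symm g))) := by
  obtain ⟨c, -, hcf⟩ := MpS.exists_unitSmul_of_proj_eq (x := MpS.unitary u) (y := x) (by rw [MpS.proj_unitary, hx])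
  -- `x g = c • P (μ₀^E(u) (P⁻¹ g))`
  have hx' : ∀ g : SchwartzMap (σ → ℝ) ℂ,
      x.1.2 g = c • schwartzTransport (euclE σ) (unitaryOpE u ((schwartzTransport (euclE σ)).symm g)) := fun g => by
    rw [hcf g, show (MpS.unitary u).1.2 = unitaryEquivPi u from rfl, unitaryEquivPi_apply, unitaryOpPi_apply]
  rw [hx' g, hx']
  simp only [map_smul, ContinuousLinearEquiv.symm_apply_apply, degProjS_unitaryOpE_comm, ← Finset.smul_sum, ← map_sum]

end Model

/-! ## §2 Any Folland frame `e : D ≃L[ℝ] ℝ^σ`: the truncation `Tr_N a := (e^*)⁻¹ P (Σ_{d<N} Π_d (P⁻¹ e^* a))` -/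

section Frame

variable {D : Type*} [NormedAddCommGroup D] [NormedSpace ℝ D] (e : D ≃L[ℝ] (σ → ℝ))

/-- **`Tr_N a → a` in `𝓢(D, ℂ)`** — ★ p863009's `hv`. [cite: Folland1989, §1.7 (1.81)] -/
theorem tendsto_degTrunc (a : SchwartzMap D ℂ) :
    Tendsto (fun N : ℕ => (schwartzTransport e).symm (schwartzTransport (euclE σ)
      (∑ d ∈ Finset.range N, degProjS d ((schwartzTransport (euclE σ)).symm (schwartzTransport e a))))) atTop (𝓝 a) := by
  have h := ((schwartzTransport e).symm.continuous.tendsto _).comp (tendsto_truncPi (schwartzTransport e a))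
  rwa [ContinuousLinearEquiv.symm_apply_apply] at h

/-- **`Tr_N a` IS FOCK-FINITE OF DEGREE `< N`**: it lies in the span of `follandHermite e β`, `|β| < N` — ★ p863009's `hvP` in the sharp form. [cite: Folland1989, Ch. 4 §5 p. 182] -/
theorem degTrunc_mem_span (a : SchwartzMap D ℂ) (N : ℕ) :
    (schwartzTransport e).symm (schwartzTransport (euclE σ)
        (∑ d ∈ Finset.range N, degProjS d ((schwartzTransport (euclE σ)).symm (schwartzTransport e a)))) ∈
      Submodule.span ℂ {x : SchwartzMap D ℂ | ∃ β : σ →₀ ℕ, β.degree < N ∧ follandHermite e β = x} := by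
  have h := Submodule.mem_map_of_mem (f := ((schwartzTransport e).symm : SchwartzMap (σ → ℝ) ℂ →L[ℂ] SchwartzMap D ℂ).toLinearMap)
    (truncPi_mem_span (schwartzTransport e a) N)
  rw [Submodule.map_span] at h
  refine Submodule.span_mono ?_ h
  rintro _ ⟨y, ⟨β, hβ, rfl⟩, rfl⟩
  exact ⟨β, hβ, rfl⟩

/-- coarse form: `Tr_N a ∈ span (range (follandHermite e))` — ★ p863009's `hvP` with `P := span (range (follandHermite e))` (the Fock-finite Schwartz data of the frame).
[cite: Folland1989, Ch. 4 §5 p. 182] -/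
theorem degTrunc_mem_span_range (a : SchwartzMap D ℂ) (N : ℕ) :
    (schwartzTransport e).symm (schwartzTransport (euclE σ)
        (∑ d ∈ Finset.range N, degProjS d ((schwartzTransport (euclE σ)).symm (schwartzTransport e a)))) ∈
      Submodule.span ℂ (Set.range (follandHermite e)) := by
  refine Submodule.span_mono ?_ (degTrunc_mem_span e a N)
  rintro _ ⟨β, -, rfl⟩
  exact ⟨β, rfl⟩

/-- **TRUNCATION INTERTWINES EVERY FRAMED-COMPACT ARCHIMEDEAN OPERATOR**: for `x ∈ Mp^𝓢` over a unitary `proj x = realify u` and every `N`,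
`Tr_N (carrierConjEquiv e x a) = carrierConjEquiv e x (Tr_N a)` (`carrierConjEquiv e x = (e^*)⁻¹ ∘ x ∘ e^*`, §1).  These are the operators through which the archimedean
compact acts on the archimedean Schwartz factor (★ `omega_sD_archToAdelic_tmul`), so truncation preserves every finite-dimensional stable type datum — r02's (2), type-free.
[cite: Folland1989, §4.2 Prop. (4.39), Ch. 4 §5 p. 182] [cite: Howe1989, §3] -/
theorem degTrunc_carrierConjEquiv_of_proj_eq_realifySp {x : MpS σ} {u : Matrix.unitaryGroup σ ℂ} (hx : MpS.proj x = realifySp σ u)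
    (a : SchwartzMap D ℂ) (N : ℕ) :
    (schwartzTransport e).symm (schwartzTransport (euclE σ)
        (∑ d ∈ Finset.range N, degProjS d ((schwartzTransport (euclE σ)).symm (schwartzTransport e (carrierConjEquiv e x.1.2 a))))) =
      carrierConjEquiv e x.1.2 ((schwartzTransport e).symm (schwartzTransport (euclE σ)
        (∑ d ∈ Finset.range N, degProjS d ((schwartzTransport (euclE σ)).symm (schwartzTransport e a))))) := by
  rw [carrierConjEquiv_apply, carrierConjEquiv_apply, ContinuousLinearEquiv.apply_symm_apply, ContinuousLinearEquiv.apply_symm_apply,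
    truncPi_apply_of_proj_eq_realifySp hx]

end Frame

/-! ## §3 The package: ONE sequence of continuous linear truncations with the three properties -/

section Package

variable {D : Type*} [NormedAddCommGroup D] [NormedSpace ℝ D] (e : D ≃L[ℝ] (σ → ℝ))

/-- **THE DEGREE-TRUNCATION PACKAGE OF A FOLLAND FRAME** (★ p863009's `hv` + `hvP` + the intertwining for `hvS`): there are continuous linear `Tr_N : 𝓢(D) →L 𝓢(D)` with
(i) `Tr_N a → a`; (ii) `Tr_N a ∈ span {follandHermite e β : |β| < N}`; (iii) `Tr_N ∘ (e^* x e_*) = (e^* x e_*) ∘ Tr_N` for every `x ∈ Mp^𝓢` over a unitary.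
[cite: Folland1989, §1.7 (1.81), §4.2 Prop. (4.39), Ch. 4 §5 p. 182] [cite: Rudin1991, Thm. 1.21] -/
theorem exists_degTrunc :
    ∃ Tr : ℕ → (SchwartzMap D ℂ →L[ℂ] SchwartzMap D ℂ),
      (∀ a : SchwartzMap D ℂ, Tendsto (fun N => Tr N a) atTop (𝓝 a)) ∧
      (∀ (N : ℕ) (a : SchwartzMap D ℂ), Tr N a ∈ Submodule.span ℂ {x : SchwartzMap D ℂ | ∃ β : σ →₀ ℕ, β.degree < N ∧ follandHermite e β = x}) ∧
      (∀ (N : ℕ) (x : MpS σ) (u : Matrix.unitaryGroup σ ℂ), MpS.proj x = realifySp σ u →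
        ∀ a : SchwartzMap D ℂ, Tr N (carrierConjEquiv e x.1.2 a) = carrierConjEquiv e x.1.2 (Tr N a)) := by
  refine ⟨fun N => (((schwartzTransport e).symm : SchwartzMap (σ → ℝ) ℂ →L[ℂ] SchwartzMap D ℂ).comp
      ((schwartzTransport (euclE σ) : SchwartzMap (EuclideanSpace ℝ σ) ℂ →L[ℂ] SchwartzMap (σ → ℝ) ℂ).comp
        ((∑ d ∈ Finset.range N, degProjS d).comp
          ((((schwartzTransport (euclE σ)).symm : SchwartzMap (σ → ℝ) ℂ →L[ℂ] SchwartzMap (EuclideanSpace ℝ σ) ℂ).comp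
            (schwartzTransport e : SchwartzMap D ℂ →L[ℂ] SchwartzMap (σ → ℝ) ℂ)))))), ?_, ?_, ?_⟩
  · intro a
    simpa only [ContinuousLinearMap.comp_apply, _root_.sum_apply, ContinuousLinearEquiv.coe_coe] using tendsto_degTrunc e a
  · intro N a
    simpa only [ContinuousLinearMap.comp_apply, _root_.sum_apply, ContinuousLinearEquiv.coe_coe] using degTrunc_mem_span e a N
  · intro N x u hx a
    simpa only [ContinuousLinearMap.comp_apply, _root_.sum_apply, ContinuousLinearEquiv.coe_coe] using
      degTrunc_carrierConjEquiv_of_proj_eq_realifySp e hx a N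

end Package

end Summit.HodgeConjecture.HodgeConjecture.Cruxes.HLiu418.K2LiuArchSWDegreeTruncation

end
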